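import Literature.MathematicalPhysics.QuantumFieldTheory.Balaban1983to89.T4SupCloseLiaison
import Literature.MathematicalPhysics.QuantumFieldTheory.Balaban1983to89.T4SiblingInsertion

/-!
# `T4Continuum.ShellCountRoad` — the COUNT × SUPPRESSION road to the single-run shell-weight bound NE7c
# (`T4IndicatorShell.ShellWeightBound`) as ONE-CALL END THEOREMS whose hypotheses are exactly the leaves of the
# ROUND-2 skeleton `t4/skeletons/NE7c-t4-ne7c-p2.md` (cell `pub-balaban`, sub-cell `t4`, spine estimate NE7c =
# node U5b; lineage t4-ne7c-p2 = co-owner #2 of BINDER row NE7c, road P2; generation 22; tree target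
# `Summits/QuantumFields/BalabanUV/T4Continuum/Support/`; ADDITIVE — imports two tree modules, modifies nothing)

HONEST FRAMING.  Finite four-torus programme, rung (B)+1 only — NOT infinite volume, NOT a mass gap, NOT the Clay
problem, NOT summit progress.  NE7c — the summable relative weight of the two-run threshold SHELLS of node U5's
matching scheme — is NOT PRINTED in [Balaban 1983–89] (the manuscripts construct ONE run) and is NOT moved by this
file.  Every declaration below is [folklore] kernel mathematics: compositions BY NAME of landed tree theorems
(`T4SupCloseLiaison.shellWeightBound_of_localRate`, `T4SiblingInsertion.siblingSuppression_of_towerBound`,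
`T4SiblingInsertion.tsum_weight_const`, `T4ShellCount.shellWeightBound_of_ageLedger`, …), finite-sum arithmetic
and one elementary fact about summable sequences.  0 sorry, 0 citations; NOTHING of Bałaban's densities, minimisers,
thresholds or couplings is asserted; every estimate is a named BINDER.

THE ROAD AND ITS TWO TIERS (skeleton §1).  S1: a shell of relative width `ρ` below a small-field threshold `θ` is the
large-field event of the SAME run at the lowered threshold `(1 − ρ)θ` cut by the small-field event
(`T4ShellCount.shellBelow_eq_largeInd_mul_smallInd`); S2: COUNT the shell-bearing slots per scale (`CubeCount`); S3:
SUM count × per-slot suppression over slots and cutoffs; S4: package as `ShellWeightBound`.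
* TIER S (print's SHARP characteristic functions at FIXED synchronised thresholds): §3 below — the END restated with
  the per-slot bound split into the printed-template suppression `e^{−p a}` (age-indexed, K-free) and the LEVEL GAIN
  `y (K − a)` (`T4ShellCount.LevelGain`, NOT PRINTED — the one open leaf S.7 of the skeleton, DECLARED to be NE7c itself
  on this tier); plus §4, the NECESSITY IDENTITY: on the sharp design the shell part of a run IS its core deficit, so
  ANY `ShellWeightBound` forces the two-run core deficit `1 − Core_K/Z_K` to be summable in `K` — the kernel form of
  «no combinatorial device supplies S.7 at fixed sharp thresholds» (with `T4ShellCount.weight_const_eq_zero`).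
* TIER η (design (η): Lipschitz cut-off profiles in place of sharp characteristic functions, identically in both runs):
  §2 below — ONE theorem `shellWeightBound_eta_of_leaves` whose hypotheses ARE the skeleton's leaves L4 (node U1b's
  `LocalRate` realised through `ReadsLevels` with a positive `ThresholdFloor`), L5 (`TermRepr` of both runs), L6 (the
  structural `TowerBound 2` data per window slot) and L8 (signs), concluding the literal `ShellWeightBound` for the
  realized shell parts with the DISPLAYED weight `Wsh_η K := Σ_{a ≤ N} n_a · lipWeight Lχ (fun _ ↦ 2) (geomWidth C θmin ϑ) a K`
  (written out in every statement; no definition is introduced),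
  its CLOSED-FORM total `2 · C₀(n, Lχ) · (C/θmin)(1 − ϑ)⁻¹`, the cube-count form of that total, the UNIFORM budget
  `≤ 2 · C₀(n, Lχ) · (C/θmin)` at EVERY `K` (the `lt_one` service with no early-`K` exceptions) and the eventual form.
* §1 is leaf L2 made kernel: the cube count `CubeCount N n V Λ` from the torus geometry (the level-`(K − a)` lattice of a
  torus with `M` final unit cubes per direction has `≤ (M·L^a)⁴` cubes of any side `≥ 1`, times a finite number `k₀` of
  slot kinds per cube).

WHAT THIS FILE DOES NOT DO.  It instantiates nothing for Bałaban's objects (the `TermRepr`s are the node owner's (o1)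
census — producers `T4FinestToWindow` / `T4AgeZeroLayer` / `T4PatternLayer`; `LocalRate` is row NE3's estimate); it
does not touch the design bill of (η) (skeleton P1–P3); it proves no estimate.  Spine PROVED 0/9 before and after.
-/

noncomputable section

open Finset MeasureTheory Filter Topology
open Literature.MathematicalPhysics.QuantumFieldTheory.Balaban1983to89
open T4IndicatorShell T4ShellCount T4LipschitzCutoff T4SiblingInsertion T4LipschitzLedger T4SupCloseLiaison
open T4EtaRateMin (Readings LocalRate)

namespace Summit.QuantumFields.BalabanUV.T4Continuum.ShellCountRoad

/-! ## §1 Leaf L2 — the CUBE COUNT from the torus geometry -/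

section CubeCountGeometry

/-- `(M · L^a)^4 = M^4 · (L^4)^a`: the number of unit cubes of the level-`(K − a)` lattice of a torus with `M` final
unit cubes per direction, written as `V · Λ^a` with `V = M⁴`, `Λ = L⁴`. [folklore] -/
theorem side_pow_four_eq (M L : ℝ) (a : ℕ) : (M * L ^ a) ^ 4 = M ^ 4 * (L ^ 4) ^ a := by
  rw [mul_pow, ← pow_mul, ← pow_mul, mul_comm a 4]

/-- **LEAF L2 (cube count) FROM THE TORUS GEOMETRY, real form.**  If the number `n a` of age-`a` slots is at most
`k₀ ×` (the number of unit cubes of the level-`(K − a)` lattice) — `k₀` = the finitely many slot KINDS per cube, and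
cubes of side `LM₂R ≥ 1` are fewer than unit cubes — then `T4ShellCount.CubeCount N n (k₀ · M⁴) (L⁴)`. [folklore] -/
theorem cubeCount_of_torus {N : ℕ} {n : ℕ → ℕ} {k₀ M L : ℝ}
    (hn : ∀ a ≤ N, (n a : ℝ) ≤ k₀ * (M * L ^ a) ^ 4) : CubeCount N n (k₀ * M ^ 4) (L ^ 4) := by
  intro a ha
  calc (n a : ℝ) ≤ k₀ * (M * L ^ a) ^ 4 := hn a ha
    _ = k₀ * M ^ 4 * (L ^ 4) ^ a := by rw [side_pow_four_eq]; ring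

/-- Integer division only lowers a count: `⌊s / c⌋ ≤ s` for naturals. [folklore] -/
theorem nat_div_le_self_real (s c : ℕ) : ((s / c : ℕ) : ℝ) ≤ (s : ℝ) := by
  exact_mod_cast Nat.div_le_self s c

/-- **LEAF L2, lattice form.**  With `M` final unit cubes per direction and blocking factor `L`, the level-`(K − a)`
lattice has side `M · L^a`; partitioned into cubes of (integer) side `c a ≥ 1` it has `(M·L^a / c a)^4 ≤ (M·L^a)^4`
cubes; with at most `k₀` slots per cube, `CubeCount N n (k₀ · M⁴) (L⁴)`. [folklore] -/
theorem cubeCount_of_sides {N : ℕ} {n : ℕ → ℕ} {M L k₀ : ℕ} {c : ℕ → ℕ}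
    (hn : ∀ a ≤ N, n a ≤ k₀ * ((M * L ^ a) / c a) ^ 4) :
    CubeCount N n ((k₀ : ℝ) * (M : ℝ) ^ 4) ((L : ℝ) ^ 4) := by
  refine cubeCount_of_torus fun a ha => ?_
  have h1 : (n a : ℝ) ≤ (k₀ : ℝ) * (((M * L ^ a) / c a : ℕ) : ℝ) ^ 4 := by exact_mod_cast hn a ha
  have h2 : (((M * L ^ a) / c a : ℕ) : ℝ) ^ 4 ≤ ((M : ℝ) * (L : ℝ) ^ a) ^ 4 := by
    have := nat_div_le_self_real (M * L ^ a) (c a)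
    push_cast at this
    exact pow_le_pow_left₀ (by positivity) this 4
  exact h1.trans (mul_le_mul_of_nonneg_left h2 (Nat.cast_nonneg _))

end CubeCountGeometry

/-! ## §2 TIER η — the one-call END over the skeleton's leaves, the displayed weight, its total and its uniform budget -/

section TierEta

variable {Dat Sit : Type*} {ι : Type*} {Ω : ℕ → ι → Type*} [∀ K τ, MeasurableSpace (Ω K τ)]
  {l₀ : ℝ} {T : ℕ → Finset ι} {A B : ℕ → ℝ → ι → ℝ} {χ : ℕ → ℝ → ℝ} {κ Lχ : ℕ → ℝ} {N : ℕ} {n : ℕ → ℕ}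
  {μ : (K : ℕ) → (τ : ι) → Measure (Ω K τ)} {m : ℕ → ι → ℕ} {slot : ℕ → ι → ℕ → Σ _ : ℕ, ℕ}
  {pol : ℕ → ι → ℕ → Pol} {θ : ℕ → ι → ℕ → ℝ} {uA uB : (K : ℕ) → (τ : ι) → ℕ → Ω K τ → ℝ}
  {RA RB : (K : ℕ) → ℝ → (τ : ι) → Ω K τ → ℝ} {R : Readings Dat Sit} {C ϑ θmin : ℝ}

/-- **TIER η END OVER THE SKELETON'S LEAVES (one call).**  Leaves: L5 = the two runs represented on common spaces
(`hA`, `hB`); L4 = node U1b's `LocalRate R C ϑ` (row NE3's predicate, `0 ≤ C`, `0 ≤ ϑ < 1`) realised by the slot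
variables (`hR`) with a positive threshold floor (`hmin`, `hθ`); L6 = the STRUCTURAL tower data — for every window slot,
cutoff and source, the run's total weight and the slot's realized sibling weight at the geometric width admit a
`TowerBound` with constant `2` (partitions of unity + integral-preserving positive steps + insertion with two shell
layers each `≤ 1`; `T4SiblingInsertion.towerBound_of_integralTower_ae`).  Conclusion: the literal
`T4IndicatorShell.ShellWeightBound` for the realized shell parts with the displayed weight `Wsh_η`.  Proof =
`T4SupCloseLiaison.shellWeightBound_of_localRate` with both `SiblingSuppression` binders discharged by
`T4SiblingInsertion.siblingSuppression_of_towerBound`.  CONDITIONAL on its binders; nothing printed asserted.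
[folklore] -/
theorem shellWeightBound_eta_of_leaves
    (hA : TermRepr l₀ T A χ κ Lχ N n μ m slot pol θ uA uB RA) (hB : TermRepr l₀ T B χ κ Lχ N n μ m slot pol θ uB uA RB)
    (hloc : LocalRate R C ϑ) (hC : 0 ≤ C) (hϑ0 : 0 ≤ ϑ) (hϑ1 : ϑ < 1)
    (hR : ReadsLevels R T μ m slot uA uB) (hmin : 0 < θmin) (hθ : ThresholdFloor T m θ θmin)
    (htA : ∀ σ ∈ (range (N + 1)).sigma (fun a => range (n a)), ∀ K t, |t| ≤ l₀ →
      TowerBound 2 (∑ τ ∈ T K, A K t τ) (∑ τ ∈ T K, sibW χ κ μ m slot pol θ uA RA (geomWidth C θmin ϑ) σ K t τ))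
    (htB : ∀ σ ∈ (range (N + 1)).sigma (fun a => range (n a)), ∀ K t, |t| ≤ l₀ →
      TowerBound 2 (∑ τ ∈ T K, B K t τ) (∑ τ ∈ T K, sibW χ κ μ m slot pol θ uB RB (geomWidth C θmin ϑ) σ K t τ)) :
    ShellWeightBound l₀ T A B (shellW χ μ m slot pol θ uA uB RA) (shellW χ μ m slot pol θ uB uA RB)
      (fun K => ∑ a ∈ range (N + 1), (n a : ℝ) * lipWeight Lχ (fun _ => (2 : ℝ)) (geomWidth C θmin ϑ) a K) :=
  shellWeightBound_of_localRate hA hB hloc hC hϑ0 hϑ1 hR hmin hθ (siblingSuppression_of_towerBound htA)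
    (siblingSuppression_of_towerBound htB) (fun _ _ => by norm_num)

/-- The same END with the two-run width left ABSTRACT (any nonnegative SUMMABLE level profile `ρ` in the sup-closeness
(F∞) — the geometric form is what row NE3 delivers, summability is all the END needs). [folklore] -/
theorem shellWeightBound_eta_of_supClose {ρ : ℕ → ℝ}
    (hA : TermRepr l₀ T A χ κ Lχ N n μ m slot pol θ uA uB RA) (hB : TermRepr l₀ T B χ κ Lχ N n μ m slot pol θ uB uA RB)
    (hF : SupClose T μ m slot θ uA uB ρ) (hρ0 : ∀ j, 0 ≤ ρ j) (hρ : Summable ρ)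
    (htA : ∀ σ ∈ (range (N + 1)).sigma (fun a => range (n a)), ∀ K t, |t| ≤ l₀ →
      TowerBound 2 (∑ τ ∈ T K, A K t τ) (∑ τ ∈ T K, sibW χ κ μ m slot pol θ uA RA ρ σ K t τ))
    (htB : ∀ σ ∈ (range (N + 1)).sigma (fun a => range (n a)), ∀ K t, |t| ≤ l₀ →
      TowerBound 2 (∑ τ ∈ T K, B K t τ) (∑ τ ∈ T K, sibW χ κ μ m slot pol θ uB RB ρ σ K t τ)) :
    ShellWeightBound l₀ T A B (shellW χ μ m slot pol θ uA uB RA) (shellW χ μ m slot pol θ uB uA RB)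
      (fun K => ∑ a ∈ range (N + 1), (n a : ℝ) * lipWeight Lχ (fun _ => (2 : ℝ)) ρ a K) :=
  shellWeightBound_of_repr hA hB hF (siblingSuppression_of_towerBound htA) (siblingSuppression_of_towerBound htB)
    (fun _ _ => by norm_num) hρ0 hρ

omit [∀ K τ, MeasurableSpace (Ω K τ)] in
/-- **THE TOTAL IN CLOSED FORM:** `Σ_K Wsh_η K = 2 · C₀(n, Lχ) · (C/θmin)(1 − ϑ)⁻¹` — structural factor × (cube
counts × Lipschitz constants summed over the window ONCE) × NE3's total width over levels.  NO `e^{−p₀}`, NO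
`LevelGain`. [folklore] -/
theorem tsum_etaWeight (N : ℕ) (n : ℕ → ℕ) (Lχ : ℕ → ℝ) {C θmin ϑ : ℝ} (hϑ0 : 0 ≤ ϑ) (hϑ1 : ϑ < 1) :
    ∑' K, (∑ a ∈ range (N + 1), (n a : ℝ) * lipWeight Lχ (fun _ => (2 : ℝ)) (geomWidth C θmin ϑ) a K)
      = 2 * C0 N (fun a => (n a : ℝ)) Lχ * (C / θmin * (1 - ϑ)⁻¹) := by
  rw [tsum_weight_const n Lχ 2 (summable_geomWidth hϑ0 hϑ1), tsum_geomWidth hϑ0 hϑ1]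

omit [∀ K τ, MeasurableSpace (Ω K τ)] in
/-- `Summable Wsh_η` from `ϑ < 1` alone (the MANDATORY field of the root). [folklore] -/
theorem summable_etaWeight (N : ℕ) (n : ℕ → ℕ) (Lχ : ℕ → ℝ) {C θmin ϑ : ℝ} (hϑ0 : 0 ≤ ϑ) (hϑ1 : ϑ < 1) :
    Summable (fun K => ∑ a ∈ range (N + 1), (n a : ℝ) * lipWeight Lχ (fun _ => (2 : ℝ)) (geomWidth C θmin ϑ) a K) :=
  summable_weight_const n Lχ 2 (summable_geomWidth hϑ0 hϑ1)

omit [∀ K τ, MeasurableSpace (Ω K τ)] in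
/-- **THE TOTAL UNDER THE CUBE COUNT (leaf L2):** `Σ_K Wsh_η K ≤ 2 · V · (Σ_{a ≤ N} Λ^a L_χ(a)) · (C/θmin)(1 − ϑ)⁻¹`.
[folklore] -/
theorem tsum_etaWeight_le_of_cubeCount {N : ℕ} {n : ℕ → ℕ} {V Λ : ℝ} {Lχ : ℕ → ℝ} {C θmin ϑ : ℝ}
    (hc : CubeCount N n V Λ) (hL : ∀ a ≤ N, 0 ≤ Lχ a) (hC : 0 ≤ C) (hmin : 0 ≤ θmin) (hϑ0 : 0 ≤ ϑ) (hϑ1 : ϑ < 1) :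
    ∑' K, (∑ a ∈ range (N + 1), (n a : ℝ) * lipWeight Lχ (fun _ => (2 : ℝ)) (geomWidth C θmin ϑ) a K)
      ≤ 2 * (V * ∑ a ∈ range (N + 1), Λ ^ a * Lχ a) * (C / θmin * (1 - ϑ)⁻¹) := by
  have h := tsum_weight_const_le_of_cubeCount (s := 2) hc hL (by norm_num) (geomWidth_nonneg hC hmin hϑ0)
    (summable_geomWidth (C := C) (θmin := θmin) hϑ0 hϑ1)
  rw [tsum_geomWidth hϑ0 hϑ1] at h
  exact h

omit [∀ K τ, MeasurableSpace (Ω K τ)] in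
/-- **THE UNIFORM BUDGET AT EVERY `K`** (the tier-S service `T4ShellCount.ageWeight_le_C0` on tier η): since
`ρ_j ≤ C/θmin` for `0 ≤ ϑ ≤ 1`, `Wsh_η K ≤ 2 · (C/θmin) · C₀(n, Lχ)` for ALL `K` — no early-`K` exceptions.
[folklore] -/
theorem etaWeight_le_uniform {N : ℕ} {n : ℕ → ℕ} {Lχ : ℕ → ℝ} {C θmin ϑ : ℝ} (hL : ∀ a ≤ N, 0 ≤ Lχ a)
    (hC : 0 ≤ C) (hmin : 0 ≤ θmin) (hϑ0 : 0 ≤ ϑ) (hϑ1 : ϑ ≤ 1) (K : ℕ) :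
    (∑ a ∈ range (N + 1), (n a : ℝ) * lipWeight Lχ (fun _ => (2 : ℝ)) (geomWidth C θmin ϑ) a K)
      ≤ 2 * (C / θmin) * C0 N (fun a => (n a : ℝ)) Lχ := by
  unfold C0
  rw [mul_sum]
  refine sum_le_sum fun a ha => ?_
  have haN : a ≤ N := Finset.mem_range_succ_iff.1 ha
  have hn0 : 0 ≤ (n a : ℝ) := Nat.cast_nonneg _
  have hLa := hL a haN
  have hρ : ∀ j, geomWidth C θmin ϑ j ≤ C / θmin := geomWidth_le_const hC hmin hϑ0 hϑ1
  have hρ0 : ∀ j, 0 ≤ geomWidth C θmin ϑ j := geomWidth_nonneg hC hmin hϑ0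
  unfold lipWeight
  split_ifs with haK
  · calc (n a : ℝ) * (Lχ a * 2 * geomWidth C θmin ϑ (K - a))
        ≤ (n a : ℝ) * (Lχ a * 2 * (C / θmin)) :=
          mul_le_mul_of_nonneg_left (mul_le_mul_of_nonneg_left (hρ _) (by positivity)) hn0
      _ = 2 * (C / θmin) * ((n a : ℝ) * Lχ a) := by ring
  · rw [mul_zero]
    have : 0 ≤ C / θmin := div_nonneg hC hmin
    positivity

omit [∀ K τ, MeasurableSpace (Ω K τ)] in
/-- **`lt_one` AT ALL `K`** (the seam's weight condition with NO early-`K` exceptions): a bad-class weight bounded by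
`W̄` and the explicit smallness `2 (C/θmin) C₀(n, Lχ) < 1 − W̄`. [folklore] -/
theorem lt_one_of_uniform {N : ℕ} {n : ℕ → ℕ} {Lχ : ℕ → ℝ} {C θmin ϑ : ℝ} {W : ℕ → ℝ} {Wbar : ℝ}
    (hL : ∀ a ≤ N, 0 ≤ Lχ a) (hC : 0 ≤ C) (hmin : 0 ≤ θmin) (hϑ0 : 0 ≤ ϑ) (hϑ1 : ϑ ≤ 1)
    (hW : ∀ K, W K ≤ Wbar) (hsmall : 2 * (C / θmin) * C0 N (fun a => (n a : ℝ)) Lχ < 1 - Wbar) (K : ℕ) :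
    W K + (∑ a ∈ range (N + 1), (n a : ℝ) * lipWeight Lχ (fun _ => (2 : ℝ)) (geomWidth C θmin ϑ) a K) < 1 := by
  have h1 := hW K
  have h2 := etaWeight_le_uniform (n := n) hL hC hmin hϑ0 hϑ1 K
  linarith

omit [∀ K τ, MeasurableSpace (Ω K τ)] in
/-- **`lt_one` ON A TAIL** (what the seam-(ζ′) socket `hybridNE7_closure'_tail` consumes): if the bad-class weight
tends to `0`, then `W K + Wsh_η K < 1` for all large `K` — from `Summable Wsh_η` alone, no smallness of
constants. [folklore] -/
theorem eventually_lt_one {N : ℕ} {n : ℕ → ℕ} {Lχ : ℕ → ℝ} {C θmin ϑ : ℝ} {W : ℕ → ℝ}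
    (hϑ0 : 0 ≤ ϑ) (hϑ1 : ϑ < 1) (hW : Tendsto W atTop (𝓝 0)) :
    ∀ᶠ K in atTop, W K + (∑ a ∈ range (N + 1), (n a : ℝ) * lipWeight Lχ (fun _ => (2 : ℝ)) (geomWidth C θmin ϑ) a K) < 1 := by
  have h := hW.add (summable_etaWeight N n Lχ (C := C) (θmin := θmin) hϑ0 hϑ1).tendsto_atTop_zero
  rw [add_zero] at h
  exact h.eventually (gt_mem_nhds (by norm_num : (0 : ℝ) < 1))

end TierEta

/-! ## §3 TIER S — the END with the per-slot bound split as (printed-template suppression) × (LEVEL GAIN) -/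

section TierSharp

variable {ι : Type*} {l₀ : ℝ} {T : ℕ → Finset ι} {A B : ℕ → ℝ → ι → ℝ}

/-- **TIER S END OVER THE SKELETON'S LEAVES.**  Leaves: S.5 = the two runs' AGE LEDGERS (the integrated shell pieces of
the sharp common refinement, per window slot, with a common per-slot RATIO `x a K`); S.6 ∧ S.7 packaged as
`T4ShellCount.LevelGain N x p y` (`0 ≤ x a K ≤ e^{−p a} · y (K − a)`, `y ≥ 0` summable — the suppression `e^{−p a}` is
the printed TEMPLATE's age-indexed factor, the gain `y` is NOT PRINTED and is NE7c itself on this tier); the union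
bounds (identities once the ledgers are realized).  Conclusion: the literal `ShellWeightBound` with weight
`K ↦ Σ_{a ≤ N} n_a · (e^{−p a} · y (K − a))`.  (`T4ShellCount.shellWeightBound_of_ageLedger` by name.) [folklore] -/
theorem shellWeightBound_sharp_of_leaves {N : ℕ} {n : ℕ → ℕ} {shAs shBs : (Σ _ : ℕ, ℕ) → ℕ → ℝ → ι → ℝ}
    {x : ℕ → ℕ → ℝ} {p y : ℕ → ℝ} {shA shB : ℕ → ℝ → ι → ℝ}
    (hLA : AgeLedger l₀ T A N n shAs x) (hLB : AgeLedger l₀ T B N n shBs x) (hgain : LevelGain N x p y)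
    (hA0 : ∀ K t, |t| ≤ l₀ → ∀ τ ∈ T K, 0 ≤ shA K t τ) (hAle : ∀ K t, |t| ≤ l₀ → ∀ τ ∈ T K, shA K t τ ≤ A K t τ)
    (hAu : ∀ K t, |t| ≤ l₀ → ∀ τ ∈ T K,
      shA K t τ ≤ ∑ σ ∈ (range (N + 1)).sigma (fun a => range (n a)), shAs σ K t τ)
    (hB0 : ∀ K t, |t| ≤ l₀ → ∀ τ ∈ T K, 0 ≤ shB K t τ) (hBle : ∀ K t, |t| ≤ l₀ → ∀ τ ∈ T K, shB K t τ ≤ B K t τ)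
    (hBu : ∀ K t, |t| ≤ l₀ → ∀ τ ∈ T K,
      shB K t τ ≤ ∑ σ ∈ (range (N + 1)).sigma (fun a => range (n a)), shBs σ K t τ) :
    ShellWeightBound l₀ T A B shA shB
      (fun K => ∑ a ∈ range (N + 1), (n a : ℝ) * (Real.exp (-p a) * y (K - a))) :=
  shellWeightBound_of_ageLedger hLA hLB (s := fun a => Real.exp (-p a)) (fun _ _ => (Real.exp_pos _).le)
    hgain.2.1 hgain.2.2 (fun a ha K => (hgain.1 a ha K).2) hA0 hAle hAu hB0 hBle hBu

/-- **TIER S WITHOUT S.7 GIVES NO ROOT.**  If the level gain is absent — the per-slot ratio of SOME counted age with a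
slot (`1 ≤ n a₀`) stays above a fixed fraction of the printed-template suppression along infinitely many cutoffs, which
nothing K-free can exclude — then the assembled weight is NOT summable, so it is not the `Wsh` of any
`ShellWeightBound`. (`T4ShellCount.not_summable_ageWeight_of_frequently_le` by name.) [folklore] -/
theorem not_summable_sharp_without_gain {N : ℕ} {n : ℕ → ℕ} {x : ℕ → ℕ → ℝ} {p : ℕ → ℝ}
    (hsup : LoweredThresholdSuppression N x p) {a₀ : ℕ} (ha₀ : a₀ ≤ N) (hn : 1 ≤ n a₀) {c : ℝ} (hc : 0 < c)
    (hsat : ∃ᶠ K in atTop, c * Real.exp (-p a₀) ≤ x a₀ K) :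
    ¬ Summable (ageWeight N (fun a => (n a : ℝ)) x) :=
  not_summable_ageWeight_of_frequently_le (fun _ _ => Nat.cast_nonneg _) (fun a ha K => (hsup a ha K).1) ha₀
    (by exact_mod_cast hn) (mul_pos hc (Real.exp_pos _)) hsat

end TierSharp

/-! ## §4 TIER S — the NECESSITY IDENTITY: on the sharp design the shell weight IS the core deficit -/

section Necessity

variable {ι : Type*} {l₀ : ℝ} {T : ℕ → Finset ι} {A B shA shB : ℕ → ℝ → ι → ℝ} {Wsh : ℕ → ℝ}

/-- POINTWISE: for ANY two families of real factors the telescoped shell pieces of `T4IndicatorShell` sum EXACTLY to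
the core deficit `∏ pᵢ − ∏ pᵢqᵢ` (`prod_eq_core_add_sum_shell` rearranged) — on the sharp design the shell part of a
term is not an upper bound but an identity. [folklore] -/
theorem sum_shellPiece_eq_deficit (p q : ℕ → ℝ) (n : ℕ) :
    ∑ i ∈ range n, shellPiece p q n i = ∏ i ∈ range n, p i - ∏ i ∈ range n, (p i * q i) := by
  have h := prod_eq_core_add_sum_shell p q n
  linarith

/-- **NECESSITY, LEDGER FORM.**  If run A's shell parts are, term by term, the core deficits `shA = A − coreA` (the
sharp design's DEFINITION, integrated), then ANY `ShellWeightBound` gives, at every cutoff and source,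
`Σ_τ A − Σ_τ coreA ≤ Wsh K · Σ_τ A`: the two-run CORE DEFICIT of the whole run is controlled by `Wsh K`. [folklore] -/
theorem deficit_le_of_shellWeightBound {coreA : ℕ → ℝ → ι → ℝ} (h : ShellWeightBound l₀ T A B shA shB Wsh)
    (hdef : ∀ K t, |t| ≤ l₀ → ∀ τ ∈ T K, shA K t τ = A K t τ - coreA K t τ) (K : ℕ) {t : ℝ} (ht : |t| ≤ l₀) :
    ∑ τ ∈ T K, A K t τ - ∑ τ ∈ T K, coreA K t τ ≤ Wsh K * ∑ τ ∈ T K, A K t τ := by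
  have h1 := h.left K t ht
  rw [sum_congr rfl (fun τ hτ => hdef K t ht τ hτ), sum_sub_distrib] at h1
  exact h1

/-- **NECESSITY, RATIO FORM.**  With positive totals, the RELATIVE core deficit `1 − Core_K/Z_K` is at most `Wsh K` …
[folklore] -/
theorem relDeficit_le_of_shellWeightBound {coreA : ℕ → ℝ → ι → ℝ} (h : ShellWeightBound l₀ T A B shA shB Wsh)
    (hdef : ∀ K t, |t| ≤ l₀ → ∀ τ ∈ T K, shA K t τ = A K t τ - coreA K t τ)
    (hpos : ∀ K t, |t| ≤ l₀ → 0 < ∑ τ ∈ T K, A K t τ) (K : ℕ) {t : ℝ} (ht : |t| ≤ l₀) :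
    1 - (∑ τ ∈ T K, coreA K t τ) / (∑ τ ∈ T K, A K t τ) ≤ Wsh K := by
  have hZ := hpos K t ht
  have h1 := deficit_le_of_shellWeightBound h hdef K ht
  rw [sub_div' (hc := hZ.ne'), one_mul]
  · exact (div_le_iff₀ hZ).2 h1

/-- … and it is nonnegative (the core never exceeds the term: `sh ≥ 0`). [folklore] -/
theorem relDeficit_nonneg_of_shellWeightBound {coreA : ℕ → ℝ → ι → ℝ} (h : ShellWeightBound l₀ T A B shA shB Wsh)
    (hdef : ∀ K t, |t| ≤ l₀ → ∀ τ ∈ T K, shA K t τ = A K t τ - coreA K t τ)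
    (hpos : ∀ K t, |t| ≤ l₀ → 0 < ∑ τ ∈ T K, A K t τ) (K : ℕ) {t : ℝ} (ht : |t| ≤ l₀) :
    0 ≤ 1 - (∑ τ ∈ T K, coreA K t τ) / (∑ τ ∈ T K, A K t τ) := by
  have hZ := hpos K t ht
  have hsh : 0 ≤ ∑ τ ∈ T K, shA K t τ := sum_nonneg fun τ hτ => h.sh_nonneg_left K t ht τ hτ
  rw [sum_congr rfl (fun τ hτ => hdef K t ht τ hτ), sum_sub_distrib] at hsh
  rw [sub_nonneg, div_le_one hZ]
  linarith

/-- **NECESSITY: `ShellWeightBound` ON THE SHARP DESIGN ⟹ THE TWO-RUN CORE DEFICIT IS SUMMABLE IN `K`** at every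
admissible source.  This is the kernel sentence behind «leaf S.7 ≡ NE7c on tier S»: the relative mass of the
configurations on which SOME declared sharp slot of run A disagrees with run B (`u^A < θ ≤ u^B` at its first mismatch)
must be summable over the cutoffs — a statement about the LAW of the tested variables near their thresholds under the
interacting measures, which no K-free count and no width-blind lowered threshold can deliver
(`T4ShellCount.weight_const_eq_zero`, `shellBelow_le_largeInd_of_width_le`). [folklore] -/
theorem summable_relDeficit_of_shellWeightBound {coreA : ℕ → ℝ → ι → ℝ} (h : ShellWeightBound l₀ T A B shA shB Wsh)
    (hdef : ∀ K t, |t| ≤ l₀ → ∀ τ ∈ T K, shA K t τ = A K t τ - coreA K t τ)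
    (hpos : ∀ K t, |t| ≤ l₀ → 0 < ∑ τ ∈ T K, A K t τ) {t : ℝ} (ht : |t| ≤ l₀) :
    Summable fun K => 1 - (∑ τ ∈ T K, coreA K t τ) / (∑ τ ∈ T K, A K t τ) :=
  h.summable.of_nonneg_of_le (fun K => relDeficit_nonneg_of_shellWeightBound h hdef hpos K ht)
    fun K => relDeficit_le_of_shellWeightBound h hdef hpos K ht

end Necessity

/-! ## §5 The junction of the tiers (by name): design (η)'s ratios ARE a level gain -/

section Junction

/-- The displayed (η) weight is a tier-S `LevelGain` certificate with `y = geomWidth C θmin ϑ` whenever the structural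
factor `2 L_χ(a)` is written as `e^{−p a}` (`p a := −log (2 L_χ a)`): tier S's missing inequality is MET on tier η by
NE3's width alone (`T4LipschitzCutoff.levelGain_of_lipWeight` by name). [folklore] -/
theorem levelGain_eta {N : ℕ} {Lχ : ℕ → ℝ} {C θmin ϑ : ℝ} (hL : ∀ a ≤ N, 0 < Lχ a) (hC : 0 ≤ C) (hmin : 0 ≤ θmin)
    (hϑ0 : 0 ≤ ϑ) (hϑ1 : ϑ < 1) :
    LevelGain N (lipWeight Lχ (fun _ => (2 : ℝ)) (geomWidth C θmin ϑ)) (fun a => -Real.log (2 * Lχ a))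
      (geomWidth C θmin ϑ) := by
  refine levelGain_of_lipWeight (fun a ha => (hL a ha).le) (fun _ _ => by norm_num) (geomWidth_nonneg hC hmin hϑ0)
    (summable_geomWidth hϑ0 hϑ1) fun a ha => ?_
  rw [neg_neg, Real.exp_log (by have := hL a ha; positivity)]
  exact le_of_eq (mul_comm _ _)

end Junction

end Summit.QuantumFields.BalabanUV.T4Continuum.ShellCountRoad

end
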